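import Summits.MatrixMultiplication.OmegaCensus.STPPVosperSlackOneLawA2
import Summits.MatrixMultiplication.OmegaCensus.STPP222SqSymmetry
import Summits.MatrixMultiplication.OmegaCensus.STPPDisjointPacking

/-!
# ω-census (abelian STPP census): two more SLACK-1 kills at `ℤ₆₁` — the `(2,2,4)+(3,4,2)²` leaves — by the `a = 2` law (kernel, modulo Hamidoune–Rødseth)

HONEST FRAMING (pub-omega census; verbatim): lottery ticket; floor = certified bounds/negative ranges.
Census STRUCTURE (seat pub-omega-stpp-1 gen 30, 2026-08-28), family (b2).  Applications of `no_isSTPP_of_slack_one_tables_prime_a2`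
(`STPPVosperSlackOneLawA2.lean`): the `Aᵢ`-side (`a = 2`) is elementary (two-run structure), the `Bᵢ`-side (`b = 4`) uses Hamidoune–Rødseth, so BOTH
THEOREMS ARE CONDITIONAL on `HamidouneRodsethInverseTheorem` (stated as printed in `STPPVosperSlackOneSteps.lean`, NOT proved in the tree).  Nothing here
is progress on `ω`.

The two orientation classes `{(2,2,4),(3,4,2),(3,4,2)}` and `{(2,2,4),(4,3,2),(4,3,2)}` are minimal beating patterns of `ℤ₆₁` (`Σ aᵢbᵢcᵢ = 64`) alive under the
python filters N7–N20, ENGINE-dead through the pair cores of record, kernel-open so far (HOME `pub-omega-stpp-1-g29/scan/KERNEL-KILLS-Z61.json`).  In the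
reading that makes the first block `(2,4,2)` — `(−A,−C,−B)` resp. `(B,C,A)` — the N18 chain has slack one with `(z, b, vol, a, L) = (24, 4, 16, 2, 16)`,
`(n, m) = (33, 17)`; target `J = {0, ±1, ±2, ±3} = {0, 1, 60, 2, 59, 3, 58}`; tables γ `(33,17,4)`, α₂ `(34,16,4)`, β `(34,17,4)` — independent python reading
HOME `pub-omega-stpp-1-g30/code/lean_tables.py` + the α₂ mirror (all `True`).

References: Y. O. Hamidoune, Ø. J. Rødseth, Acta Arith. 92 (2000) 251–262; A. G. Vosper, J. London Math. Soc. 31 (1956); M. B. Nathanson, GTM 165,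
Thm 2.7; H. Cohn, R. Kleinberg, B. Szegedy, C. Umans, FOCS 2005 (arXiv:math/0511460), Def. 5.1.
-/

open Finset
open scoped Pointwise

namespace Summit.MatrixMultiplication.OmegaCensus.CubeNB

open Literature.Computability.AlgebraicComplexity
open Literature.Combinatorics.Additive
open Summit.MatrixMultiplication.OmegaCensus.STPPKneser

/-! ## Target and tables -/

section Tables

/-- The target at `61` for `(a, b) = (2, 4)`: every element is `0` or `±k` with `k < 4` (the `±k⁻¹`, `k < 2`, part is `±1`). [folklore] -/
theorem target_61_a2_b4 : ∀ jv ∈ ({0, 1, 60, 2, 59, 3, 58} : Finset ℕ),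
    jv = 0 ∨ (∃ k ∈ range 4, 1 ≤ k ∧ (jv = k ∨ jv + k = 61)) ∨ (∃ k ∈ range 2, 1 ≤ k ∧ (jv * k % 61 = 1 ∨ jv * k % 61 = 61 - 1)) := by
  decide

/-- Tight-type table `(n, m, r) = (33, 17, 4)` at `61` with target `{0, ±1, ±2, ±3}`. [folklore] -/
theorem table_33_17_4_a2b4 : ∀ j < 61, ∀ t < 61, (∀ i < 17, (t + j * i) % 61 < 33) →
    (∀ k < 17, 4 ∣ (t + j * k) % 61 - #((range 17).filter fun i => (t + j * i) % 61 < (t + j * k) % 61)) →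
    j ∈ ({0, 1, 60, 2, 59, 3, 58} : Finset ℕ) := by
  decide +kernel

/-- Case-α₂ table `(n₁, L, r) = (34, 16, 4)` at `61` with target `{0, ±1, ±2, ±3}`. [folklore] -/
theorem tableAlpha2_61_34_16_4 : tableAlpha2 61 34 16 4 {0, 1, 60, 2, 59, 3, 58} = true := by
  decide +kernel

/-- Case-β table `(n₁, m, b) = (34, 17, 4)` at `61` with target `{0, ±1, ±2, ±3}`. [folklore] -/
theorem tableBeta_61_34_17_4_a2b4 : tableBeta 61 34 17 4 {0, 1, 60, 2, 59, 3, 58} = true := by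
  decide +kernel

end Tables

/-! ## The two conditional kills -/

section Kills

/-- **`{(2,2,4),(3,4,2),(3,4,2)}` has no STPP family in `ℤ₆₁`, PROVIDED the Hamidoune–Rødseth inverse theorem** (`a = 2` slack-1 law in the reading
`(a,c,b)`, i.e. for the STPP family `(−A,−C,−B)` (`isSTPP_negSwap`), block `(2,4,2)`: `(z, b, vol, a, L) = (24, 4, 16, 2, 16)`).
[cite: CohnKleinbergSzegedyUmans2005, Def. 5.1] [cite: HamidouneRodseth2000, main theorem (§1, p. 252)] [cite: Nathanson1996, Thm 2.7] -/
theorem no_isSTPP_zmod61_224_342_342_of_hamidouneRodseth (hHR : HamidouneRodsethInverseTheorem)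
    (A B C : Fin 3 → Finset (ZMod 61)) (hS : IsSTPP A B C)
    (hA : ∀ i, #(A i) = ![2, 3, 3] i) (hB : ∀ i, #(B i) = ![2, 4, 4] i) (hC : ∀ i, #(C i) = ![4, 2, 2] i) :
    False := by
  haveI : Fact (Nat.Prime 61) := ⟨prime_61⟩
  have hAne : ∀ i, (A i).Nonempty := fun i => card_pos.1 (by rw [hA]; fin_cases i <;> simp)
  have hBne : ∀ i, (B i).Nonempty := fun i => card_pos.1 (by rw [hB]; fin_cases i <;> simp)
  have hCne : ∀ i, (C i).Nonempty := fun i => card_pos.1 (by rw [hC]; fin_cases i <;> simp)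
  -- the family (−A, −C, −B)
  set A' : Fin 3 → Finset (ZMod 61) := fun t => (A t).image Neg.neg with hA'
  set B' : Fin 3 → Finset (ZMod 61) := fun t => (C t).image Neg.neg with hB'
  set C' : Fin 3 → Finset (ZMod 61) := fun t => (B t).image Neg.neg with hC'
  have hS' : IsSTPP A' B' C' := STPP222SqNeg.isSTPP_negSwap hS
  have hcA' : ∀ t, #(A' t) = #(A t) := fun t => Finset.card_image_of_injective _ neg_injective
  have hcB' : ∀ t, #(B' t) = #(C t) := fun t => Finset.card_image_of_injective _ neg_injective
  have hcC' : ∀ t, #(C' t) = #(B t) := fun t => Finset.card_image_of_injective _ neg_injective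
  have hAne' : ∀ t, (A' t).Nonempty := fun t => (hAne t).image _
  have hBne' : ∀ t, (B' t).Nonempty := fun t => (hCne t).image _
  have hCne' : ∀ t, (C' t).Nonempty := fun t => (hBne t).image _
  have e0 : (univ : Finset (Fin 3)).erase 0 = {1, 2} := by decide
  have hz : ∑ k ∈ (univ : Finset (Fin 3)).erase 0, #(A' k) * #(C' k) = 24 := by
    rw [e0, Finset.sum_pair (by decide)]; simp [hcA', hcC', hA, hB]
  have hL : ∑ k ∈ (univ : Finset (Fin 3)).erase 0, #(B' k) * #(C' k) = 16 := by
    rw [e0, Finset.sum_pair (by decide)]; simp [hcB', hcC', hC, hB]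
  have ha : #(A' 0) = 2 := by rw [hcA', hA]; simp
  have hb : #(B' 0) = 4 := by rw [hcB', hC]; simp
  have hvol : #(A' 0) * #(B' 0) * #(C' 0) = 16 := by rw [hcA', hcB', hcC', hA, hB, hC]; simp
  exact no_isSTPP_of_slack_one_tables_prime_a2 hHR A' B' C' hS' hAne' hBne' hCne' 0 ⟨1, by decide⟩ ha hb hvol hz hL rfl (by norm_num)
    (by norm_num) (by norm_num) (by norm_num) (m := 17) (n := 33) rfl rfl target_61_a2_b4 table_33_17_4_a2b4 tableAlpha2_61_34_16_4
    tableBeta_61_34_17_4_a2b4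

/-- **`{(2,2,4),(4,3,2),(4,3,2)}` has no STPP family in `ℤ₆₁`, PROVIDED the Hamidoune–Rødseth inverse theorem** (`a = 2` slack-1 law in the reading
`(b,c,a)`, i.e. for the STPP family `(B,C,A)` (`stpp_rotate`), block `(2,4,2)`: `(z, b, vol, a, L) = (24, 4, 16, 2, 16)`).
[cite: CohnKleinbergSzegedyUmans2005, Def. 5.1] [cite: HamidouneRodseth2000, main theorem (§1, p. 252)] [cite: Nathanson1996, Thm 2.7] -/
theorem no_isSTPP_zmod61_224_432_432_of_hamidouneRodseth (hHR : HamidouneRodsethInverseTheorem)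
    (A B C : Fin 3 → Finset (ZMod 61)) (hS : IsSTPP A B C)
    (hA : ∀ i, #(A i) = ![2, 4, 4] i) (hB : ∀ i, #(B i) = ![2, 3, 3] i) (hC : ∀ i, #(C i) = ![4, 2, 2] i) :
    False := by
  haveI : Fact (Nat.Prime 61) := ⟨prime_61⟩
  have hS' : IsSTPP B C A := stpp_rotate hS
  have hAne : ∀ i, (A i).Nonempty := fun i => card_pos.1 (by rw [hA]; fin_cases i <;> simp)
  have hBne : ∀ i, (B i).Nonempty := fun i => card_pos.1 (by rw [hB]; fin_cases i <;> simp)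
  have hCne : ∀ i, (C i).Nonempty := fun i => card_pos.1 (by rw [hC]; fin_cases i <;> simp)
  have e0 : (univ : Finset (Fin 3)).erase 0 = {1, 2} := by decide
  have hz : ∑ k ∈ (univ : Finset (Fin 3)).erase 0, #(B k) * #(A k) = 24 := by
    rw [e0, Finset.sum_pair (by decide)]; simp [hA, hB]
  have hL : ∑ k ∈ (univ : Finset (Fin 3)).erase 0, #(C k) * #(A k) = 16 := by
    rw [e0, Finset.sum_pair (by decide)]; simp [hA, hC]
  have ha : #(B 0) = 2 := by rw [hB]; simp
  have hb : #(C 0) = 4 := by rw [hC]; simp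
  have hvol : #(B 0) * #(C 0) * #(A 0) = 16 := by rw [hA, hB, hC]; simp
  exact no_isSTPP_of_slack_one_tables_prime_a2 hHR B C A hS' hBne hCne hAne 0 ⟨1, by decide⟩ ha hb hvol hz hL rfl (by norm_num)
    (by norm_num) (by norm_num) (by norm_num) (m := 17) (n := 33) rfl rfl target_61_a2_b4 table_33_17_4_a2b4 tableAlpha2_61_34_16_4
    tableBeta_61_34_17_4_a2b4

end Kills

end Summit.MatrixMultiplication.OmegaCensus.CubeNB
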